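import Mathlib
import Summits.RiemannHypothesis.RiemannHypothesis.Theorems.IntegerScrewPathUsers
import Summits.RiemannHypothesis.RiemannHypothesis.Theorems.IntegerScrewWalkPoincareMertens
import HarnessLib

/-!
# Route `IntegerScrew` — PROPOSITION K's flow: the ROOT functional of an atom against its Dirichlet form,
# through the smallest-prime tree (CONTINUUM-LIMIT §24.11, §26.6)

The dominant cells of THEOREM P₀ (CONTINUUM-LIMIT 24.5 (g), 24.11) are the cuts `{1}` against the rest of an atom
`𝒜 = {x ≤ R : x is p-smooth}` (harmonic weights `1/x`).  Their ROOM functional is the root functional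
`F(g) = Σ_{x∈𝒜}(1/x)(g(x) − g(1))`.  PROP. K bounds it by the smallest-prime TREE used as a FLOW from the root:
telescoping `g(x) − g(1)` along the path `x → x/minFac x → ⋯ → 1` and exchanging the sums,
`F(g) = Σ_y J_y·(g(y) − g(y/minFac y))` with `J_y = Σ_{x∈𝒜 : y on the path of x} 1/x ≤ π_y/y`
(`π_y = Π_{q ≤ minFac y}(1 − 1/q)⁻¹`, `IntegerScrewWalkPoincareMertens.sum_inv_path_users_le`), and Cauchy–Schwarz
edge by edge gives

* **`root_functional_sq_le`** — for every `p`, `R`, `g`: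
  `(Σ_{x∈𝒜}(1/x)(g(x) − g(1)))² ≤ [Σ_{2≤y≤R} π_y²/(y·log minFac y)] · D_𝒜(g)`,
  `D_𝒜(g) = Σ_{x∈𝒜}(1/x)Σ_{n∣x}Λ(n)(g(x) − g(x/n))²`.

The bracket is an explicit prime sum, bounded by `O(log R·log log R)` in `IntegerScrewPropK`; in κ-units this is
PROP. K: `κ(dominant cell) = O(log log R)`.  Here: `pathSet` (the path as a finset, by well-founded recursion), the GENERAL path-flow inequality
`functional_sq_le_of_loads` (any user set `S`, edge set `T`, loads `P`; reused by PROP. K″'s hub legs),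
`mem_pathSet` (path elements divide `x`, the quotient is `(minFac y + 1)`-smooth), `sub_eq_sum_pathSet` (the
telescoping identity), `functional_eq_sum_edges` (the exchange of sums), `root_functional_sq_le`.
RH-free, elementary.  Nothing in this file bears on the truth of RH.
References: CONTINUUM-LIMIT §24.11 (rh-explicit A6-PIVOT); M. Suzuki, J. Lond. Math. Soc. (2) 108 (2023)
1448–1487 [Suzuki2023] for the screw matrices this serves.
-/

noncomputable section

set_option linter.dupNamespace false -- D-0017: `Summit.<S>.<S>.…` is the designed namespace

namespace Summit.RiemannHypothesis.RiemannHypothesis.Theorems.IntegerScrew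

open Finset Real
open ArithmeticFunction (vonMangoldt)

/-- A prime `p ≤ N` is `(N+1)`-smooth (copy of `IntegerScrewWalkPoincareMertens.prime_mem_smoothNumbers_succ`, whose
olean was unavailable at filing). -/
private theorem prime_mem_smoothNumbers_succ' {p N : ℕ} (hp : p.Prime) (hpN : p ≤ N) :
    p ∈ Nat.smoothNumbers (N + 1) := by
  refine ⟨hp.ne_zero, fun q hq => ?_⟩
  rw [Nat.primeFactorsList_prime hp, List.mem_singleton] at hq
  omega

/-! ### The smallest-prime path as a finset -/

/-- The smallest-prime path of `x` down to (but excluding) `1`: `{x, x/minFac x, …}`; empty for `x ≤ 1`.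
[cite: Suzuki2023, §1 (the screw matrices S_M whose pivot/spectral theory this serves)] -/
def pathSet : ℕ → Finset ℕ
  | x => if _h : 2 ≤ x then insert x (pathSet (x / x.minFac)) else ∅
  termination_by x => x
  decreasing_by exact Nat.div_lt_self (by omega) (Nat.minFac_prime (by omega)).one_lt

/-- Below `2` the smallest-prime path is empty. [folklore] -/
theorem pathSet_of_lt_two {x : ℕ} (h : x < 2) : pathSet x = ∅ := by
  rw [pathSet]; simp [show ¬(2 ≤ x) by omega]

/-- The defining step of the smallest-prime path: `path(x) = {x} ∪ path(x / minFac x)` for `x ≥ 2`. [folklore] -/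
theorem pathSet_of_two_le {x : ℕ} (h : 2 ≤ x) : pathSet x = insert x (pathSet (x / x.minFac)) := by
  rw [pathSet]; simp [h]

/-- Elements of the path are in `[2, x]`. -/
theorem mem_pathSet_bounds {x y : ℕ} (hy : y ∈ pathSet x) : 2 ≤ y ∧ y ≤ x := by
  induction x using Nat.strong_induction_on generalizing y with
  | _ x ih =>
    rcases lt_or_ge x 2 with h | h
    · rw [pathSet_of_lt_two h] at hy; simp at hy
    · rw [pathSet_of_two_le h, Finset.mem_insert] at hy
      rcases hy with rfl | hy
      · exact ⟨h, le_rfl⟩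
      · have hlt : x / x.minFac < x := Nat.div_lt_self (by omega) (Nat.minFac_prime (by omega)).one_lt
        have := ih _ hlt hy
        exact ⟨this.1, this.2.trans hlt.le⟩

/-- `x` is not on the path of `x / minFac x`. -/
theorem not_mem_pathSet_div {x : ℕ} (h : 2 ≤ x) : x ∉ pathSet (x / x.minFac) := by
  intro hx
  have := (mem_pathSet_bounds hx).2
  have hlt : x / x.minFac < x := Nat.div_lt_self (by omega) (Nat.minFac_prime (by omega)).one_lt
  omega

/-- **Path elements are the users' witnesses**: if `y` is on the path of `x` then `y ∣ x` and every prime of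
`x / y` is `≤ minFac y` (i.e. `x / y` is `(minFac y + 1)`-smooth). -/
theorem mem_pathSet {x y : ℕ} (hy : y ∈ pathSet x) : y ∣ x ∧ x / y ∈ Nat.smoothNumbers (y.minFac + 1) := by
  induction x using Nat.strong_induction_on generalizing y with
  | _ x ih =>
    rcases lt_or_ge x 2 with h | h
    · rw [pathSet_of_lt_two h] at hy; simp at hy
    · rw [pathSet_of_two_le h, Finset.mem_insert] at hy
      have hx0 : x ≠ 0 := by omega
      rcases hy with rfl | hy
      · refine ⟨dvd_rfl, ?_⟩
        rw [Nat.div_self (by omega)]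
        exact ⟨one_ne_zero, fun p hp => by simp [Nat.primeFactorsList_one] at hp⟩
      · set x' := x / x.minFac with hx'
        have hlt : x' < x := Nat.div_lt_self (by omega) (Nat.minFac_prime (by omega)).one_lt
        obtain ⟨hyx', hsm⟩ := ih x' hlt hy
        have hy2 : 2 ≤ y := (mem_pathSet_bounds hy).1
        have hxeq : x = x.minFac * x' := (Nat.mul_div_cancel' (Nat.minFac_dvd x)).symm
        refine ⟨hyx'.trans ⟨x.minFac, by rw [mul_comm]; exact hxeq⟩, ?_⟩
        -- x / y = minFac x * (x' / y), and minFac x ≤ minFac y (y ∣ x, y ≥ 2)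
        have hdiv : x / y = x.minFac * (x' / y) := by
          conv_lhs => rw [hxeq]
          exact Nat.mul_div_assoc _ hyx'
        have hmf : x.minFac ≤ y.minFac := by
          have hyx : y.minFac ∣ x := (Nat.minFac_dvd y).trans (hyx'.trans (Nat.div_dvd_of_dvd (Nat.minFac_dvd x)))
          exact Nat.minFac_le_of_dvd (Nat.minFac_prime (by omega)).two_le hyx
        rw [hdiv]
        refine Nat.mul_mem_smoothNumbers ?_ hsm
        exact prime_mem_smoothNumbers_succ' (Nat.minFac_prime (by omega)) hmf

/-- Path elements of a `p`-smooth number are `p`-smooth. -/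
theorem mem_smoothNumbers_of_mem_pathSet {p x y : ℕ} (hx : x ∈ Nat.smoothNumbers p) (hy : y ∈ pathSet x) :
    y ∈ Nat.smoothNumbers p :=
  Nat.mem_smoothNumbers_of_dvd hx (mem_pathSet hy).1

/-- **Telescoping along the path**: `g(x) − g(1) = Σ_{y ∈ pathSet x} (g(y) − g(y/minFac y))` for `x ≥ 1`. -/
theorem sub_eq_sum_pathSet (g : ℕ → ℝ) {x : ℕ} (hx : 1 ≤ x) :
    g x - g 1 = ∑ y ∈ pathSet x, (g y - g (y / y.minFac)) := by
  induction x using Nat.strong_induction_on with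
  | _ x ih =>
    rcases lt_or_ge x 2 with h | h
    · have : x = 1 := by omega
      subst this; simp [pathSet_of_lt_two]
    · have hlt : x / x.minFac < x := Nat.div_lt_self (by omega) (Nat.minFac_prime (by omega)).one_lt
      have h1 : 1 ≤ x / x.minFac := Nat.div_pos (Nat.minFac_le (by omega)) (Nat.minFac_pos x)
      rw [pathSet_of_two_le h, Finset.sum_insert (not_mem_pathSet_div h), ← ih _ hlt h1]
      ring

/-! ### A path functional through the tree: general user set `S`, edge set `T`, loads `P` -/

/-- **Exchange of sums, general form**: for `S ⊆ ℕ_{≥1}` whose path nodes all lie in `T`,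
`Σ_{x∈S}(1/x)(g x − g 1) = Σ_{y∈T} (g y − g(y/minFac y))·J_y`, `J_y = Σ_{x∈S : y ∈ pathSet x} 1/x`. -/
theorem functional_eq_sum_edges (S T : Finset ℕ) (hS1 : ∀ x ∈ S, 1 ≤ x)
    (hT : ∀ x ∈ S, ∀ y ∈ pathSet x, y ∈ T) (g : ℕ → ℝ) :
    ∑ x ∈ S, (1 / (x : ℝ)) * (g x - g 1) =
      ∑ y ∈ T, (g y - g (y / y.minFac)) * ∑ x ∈ S.filter (fun x => y ∈ pathSet x), (1 / (x : ℝ)) := by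
  have hstep : ∑ x ∈ S, (1 / (x : ℝ)) * (g x - g 1) =
      ∑ x ∈ S, ∑ y ∈ pathSet x, (1 / (x : ℝ)) * (g y - g (y / y.minFac)) := by
    refine Finset.sum_congr rfl fun x hx => ?_
    rw [sub_eq_sum_pathSet g (hS1 x hx), Finset.mul_sum]
  rw [hstep]
  rw [Finset.sum_comm' (t' := T) (s' := fun y => S.filter (fun x => y ∈ pathSet x))]
  · refine Finset.sum_congr rfl fun y _ => ?_
    rw [Finset.mul_sum]
    exact Finset.sum_congr rfl fun x _ => by ring
  · intro x y
    constructor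
    · rintro ⟨hx, hy⟩
      exact ⟨Finset.mem_filter.2 ⟨hx, hy⟩, hT x hx y hy⟩
    · rintro ⟨hx, _⟩
      exact ⟨(Finset.mem_filter.1 hx).1, (Finset.mem_filter.1 hx).2⟩

/-- The smallest-prime death is part of the Dirichlet form (copy of `IntegerScrewWalkPoincareMertens`'s private
lemma): for `2 ≤ y`, `(1/y)·log(minFac y)·(g y − g(y/minFac y))² ≤ (1/y)·Σ_{n ∣ y} Λ(n)(g y − g(y/n))²`. -/
private theorem minFac_term_le_dirichlet_term_rf (g : ℕ → ℝ) {y : ℕ} (hy : 2 ≤ y) :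
    (1 / (y : ℝ)) * (Real.log y.minFac * (g y - g (y / y.minFac)) ^ 2) ≤
      (1 / (y : ℝ)) * ∑ n ∈ y.divisors, (vonMangoldt n : ℝ) * (g y - g (y / n)) ^ 2 := by
  refine mul_le_mul_of_nonneg_left ?_ (by positivity)
  have hp : y.minFac.Prime := Nat.minFac_prime (by omega)
  have hmem : y.minFac ∈ y.divisors := Nat.mem_divisors.2 ⟨Nat.minFac_dvd y, by omega⟩
  have hΛ : (vonMangoldt y.minFac : ℝ) = Real.log y.minFac := by
    rw [ArithmeticFunction.vonMangoldt_apply_prime hp]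
  calc Real.log y.minFac * (g y - g (y / y.minFac)) ^ 2
      = (vonMangoldt y.minFac : ℝ) * (g y - g (y / y.minFac)) ^ 2 := by rw [hΛ]
    _ ≤ ∑ n ∈ y.divisors, (vonMangoldt n : ℝ) * (g y - g (y / n)) ^ 2 :=
        Finset.single_le_sum (f := fun n => (vonMangoldt n : ℝ) * (g y - g (y / n)) ^ 2)
          (fun n _ => mul_nonneg ArithmeticFunction.vonMangoldt_nonneg (sq_nonneg _)) hmem

/-- **The path-flow inequality with prescribed loads** (Cauchy–Schwarz edge by edge).  Let `S ⊆ ℕ_{≥1}` have all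
its path nodes in `T ⊆ ℕ_{≥2}`, and let the users of every `y ∈ T` weigh `J_y ≤ P_y/y`.  Then
`(Σ_{x∈S}(1/x)(g x − g 1))² ≤ [Σ_{y∈T} P_y²/(y·log minFac y)]·Σ_{y∈T}(1/y)Σ_{n∣y}Λ(n)(g y − g(y/n))²`
(the tree flow of PROP. K for `S = T ∪ {1}` an atom; the hub leg `α` of PROP. K″ for `S` the `Q`-rough hubs). -/
theorem functional_sq_le_of_loads (S T : Finset ℕ) (hS1 : ∀ x ∈ S, 1 ≤ x)
    (hT : ∀ x ∈ S, ∀ y ∈ pathSet x, y ∈ T) (hT2 : ∀ y ∈ T, 2 ≤ y) (P : ℕ → ℝ)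
    (hJ : ∀ y ∈ T, ∑ x ∈ S.filter (fun x => y ∈ pathSet x), (1 / (x : ℝ)) ≤ (1 / (y : ℝ)) * P y)
    (g : ℕ → ℝ) :
    (∑ x ∈ S, (1 / (x : ℝ)) * (g x - g 1)) ^ 2 ≤
      (∑ y ∈ T, P y ^ 2 / ((y : ℝ) * Real.log y.minFac)) *
        ∑ y ∈ T, (1 / (y : ℝ)) * ∑ n ∈ y.divisors, (vonMangoldt n : ℝ) * (g y - g (y / n)) ^ 2 := by
  set J : ℕ → ℝ := fun y => ∑ x ∈ S.filter (fun x => y ∈ pathSet x), (1 / (x : ℝ)) with hJdef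
  set d : ℕ → ℝ := fun y => g y - g (y / y.minFac) with hd
  set c : ℕ → ℝ := fun y => (1 / (y : ℝ)) * Real.log y.minFac with hc
  have hF : ∑ x ∈ S, (1 / (x : ℝ)) * (g x - g 1) = ∑ y ∈ T, d y * J y :=
    functional_eq_sum_edges S T hS1 hT g
  rw [hF]
  have hcpos : ∀ y ∈ T, 0 < c y := by
    intro y hy
    have hy2 : 2 ≤ y := hT2 y hy
    have : 0 < Real.log y.minFac :=
      Real.log_pos (by exact_mod_cast (Nat.minFac_prime (by omega)).one_lt)
    simp only [hc]; positivity
  -- Cauchy–Schwarz edge by edge: (Σ d J)² ≤ (Σ J²/c)(Σ c d²)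
  have hCS : (∑ y ∈ T, d y * J y) ^ 2 ≤ (∑ y ∈ T, J y ^ 2 / c y) * ∑ y ∈ T, c y * d y ^ 2 := by
    refine Finset.sum_sq_le_sum_mul_sum_of_sq_le_mul T (fun y hy => ?_) (fun y hy => ?_) (fun y hy => ?_)
    · exact div_nonneg (sq_nonneg _) (hcpos y hy).le
    · exact mul_nonneg (hcpos y hy).le (sq_nonneg _)
    · have hc0 := (hcpos y hy).ne'
      have : J y ^ 2 / c y * (c y * d y ^ 2) = (d y * J y) ^ 2 := by
        field_simp
      rw [this]
  -- the energy: J_y²/c_y ≤ P_y²/(y log minFac y)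
  have hE : ∑ y ∈ T, J y ^ 2 / c y ≤ ∑ y ∈ T, P y ^ 2 / ((y : ℝ) * Real.log y.minFac) := by
    refine Finset.sum_le_sum fun y hy => ?_
    have hy2 : 2 ≤ y := hT2 y hy
    have hy0 : (0 : ℝ) < y := by exact_mod_cast (show 0 < y by omega)
    have hlog : 0 < Real.log y.minFac :=
      Real.log_pos (by exact_mod_cast (Nat.minFac_prime (by omega)).one_lt)
    have hJ0 : 0 ≤ J y := Finset.sum_nonneg fun x _ => by positivity
    have hJle : J y ≤ (1 / (y : ℝ)) * P y := hJ y hy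
    have hJsq : J y ^ 2 ≤ ((1 / (y : ℝ)) * P y) ^ 2 := pow_le_pow_left₀ hJ0 hJle 2
    calc J y ^ 2 / c y ≤ ((1 / (y : ℝ)) * P y) ^ 2 / c y := div_le_div_of_nonneg_right hJsq (hcpos y hy).le
      _ = P y ^ 2 / ((y : ℝ) * Real.log y.minFac) := by
          simp only [hc]
          field_simp
  -- the Dirichlet side
  have hD : ∑ y ∈ T, c y * d y ^ 2 ≤
      ∑ y ∈ T, (1 / (y : ℝ)) * ∑ n ∈ y.divisors, (vonMangoldt n : ℝ) * (g y - g (y / n)) ^ 2 := by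
    refine Finset.sum_le_sum fun y hy => ?_
    have hy2 : 2 ≤ y := hT2 y hy
    have := minFac_term_le_dirichlet_term_rf g hy2
    simp only [hc, hd]
    calc 1 / (y : ℝ) * Real.log y.minFac * (g y - g (y / y.minFac)) ^ 2
        = 1 / (y : ℝ) * (Real.log y.minFac * (g y - g (y / y.minFac)) ^ 2) := by ring
      _ ≤ _ := this
  have hE0 : 0 ≤ ∑ y ∈ T, J y ^ 2 / c y :=
    Finset.sum_nonneg fun y hy => div_nonneg (sq_nonneg _) (hcpos y hy).le
  have hD0 : 0 ≤ ∑ y ∈ T, c y * d y ^ 2 :=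
    Finset.sum_nonneg fun y hy => mul_nonneg (hcpos y hy).le (sq_nonneg _)
  calc (∑ y ∈ T, d y * J y) ^ 2 ≤ (∑ y ∈ T, J y ^ 2 / c y) * ∑ y ∈ T, c y * d y ^ 2 := hCS
    _ ≤ _ := mul_le_mul hE hD hD0 (hE0.trans hE)

/-! ### The root functional of an atom (PROP. K's flow) -/

/-- The edge load `J_y` is at most the harmonic mass of the users of the edge at `y`:
`J_y ≤ (1/y)·Π_{q ≤ minFac y}(1 − 1/q)⁻¹` (`sum_inv_path_users_le`). -/
theorem edge_load_le {p R y : ℕ} (hy : 1 ≤ y) :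
    ∑ x ∈ ((Icc 1 R).filter (· ∈ Nat.smoothNumbers p)).filter (fun x => y ∈ pathSet x), (1 / (x : ℝ)) ≤
      (1 / (y : ℝ)) * ∏ q ∈ (y.minFac + 1).primesBelow, (1 - 1 / (q : ℝ))⁻¹ := by
  refine le_trans ?_ (sum_inv_path_users_le (M := R) hy)
  refine Finset.sum_le_sum_of_subset_of_nonneg ?_ fun x _ _ => by positivity
  intro x hx
  have hx' := Finset.mem_filter.1 hx
  exact Finset.mem_filter.2 ⟨(Finset.mem_filter.1 hx'.1).1, mem_pathSet hx'.2⟩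

/-- **PROP. K's flow inequality (CONTINUUM-LIMIT 24.11 (i)–(ii)).**  For every `p`, `R` and `g`, with
`𝒜 = {x ≤ R : x p-smooth}` and `π_y = Π_{q ≤ minFac y}(1 − 1/q)⁻¹`:
`(Σ_{x∈𝒜}(1/x)(g x − g 1))² ≤ [Σ_{2≤y≤R} π_y²/(y·log minFac y)]·Σ_{x∈𝒜}(1/x)Σ_{n∣x}Λ(n)(g x − g(x/n))²`. -/
theorem root_functional_sq_le (p R : ℕ) (g : ℕ → ℝ) :
    (∑ x ∈ (Icc 1 R).filter (· ∈ Nat.smoothNumbers p), (1 / (x : ℝ)) * (g x - g 1)) ^ 2 ≤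
      (∑ y ∈ Icc 2 R, (∏ q ∈ (y.minFac + 1).primesBelow, (1 - 1 / (q : ℝ))⁻¹) ^ 2 /
          ((y : ℝ) * Real.log y.minFac)) *
        ∑ x ∈ (Icc 1 R).filter (· ∈ Nat.smoothNumbers p),
          (1 / (x : ℝ)) * ∑ n ∈ x.divisors, (vonMangoldt n : ℝ) * (g x - g (x / n)) ^ 2 := by
  set S := (Icc 1 R).filter (· ∈ Nat.smoothNumbers p) with hS
  set T := S.filter (2 ≤ ·) with hT
  set P : ℕ → ℝ := fun y => ∏ q ∈ (y.minFac + 1).primesBelow, (1 - 1 / (q : ℝ))⁻¹ with hP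
  have hS1 : ∀ x ∈ S, 1 ≤ x := fun x hx => (Finset.mem_Icc.1 (Finset.mem_filter.1 hx).1).1
  have hST : ∀ x ∈ S, ∀ y ∈ pathSet x, y ∈ T := by
    intro x hx y hy
    have hx' := Finset.mem_filter.1 hx
    have hb := mem_pathSet_bounds hy
    refine Finset.mem_filter.2 ⟨Finset.mem_filter.2 ⟨Finset.mem_Icc.2 ⟨by omega, ?_⟩, ?_⟩, hb.1⟩
    · exact hb.2.trans (Finset.mem_Icc.1 hx'.1).2
    · exact mem_smoothNumbers_of_mem_pathSet hx'.2 hy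
  have hT2 : ∀ y ∈ T, 2 ≤ y := fun y hy => (Finset.mem_filter.1 hy).2
  have hJ : ∀ y ∈ T, ∑ x ∈ S.filter (fun x => y ∈ pathSet x), (1 / (x : ℝ)) ≤ (1 / (y : ℝ)) * P y :=
    fun y hy => edge_load_le (p := p) (R := R) (by have := hT2 y hy; omega)
  have h := functional_sq_le_of_loads S T hS1 hST hT2 P hJ g
  -- enlarge both factors: T ⊆ Icc 2 R and T ⊆ S
  have hE : ∑ y ∈ T, P y ^ 2 / ((y : ℝ) * Real.log y.minFac) ≤
      ∑ y ∈ Icc 2 R, P y ^ 2 / ((y : ℝ) * Real.log y.minFac) := by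
    refine Finset.sum_le_sum_of_subset_of_nonneg ?_ fun y hy _ => ?_
    · intro y hy
      have hy' := Finset.mem_filter.1 hy
      have hy1 := Finset.mem_Icc.1 (Finset.mem_filter.1 hy'.1).1
      exact Finset.mem_Icc.2 ⟨hy'.2, hy1.2⟩
    · have hy2 := (Finset.mem_Icc.1 hy).1
      have : 0 < Real.log y.minFac :=
        Real.log_pos (by exact_mod_cast (Nat.minFac_prime (by omega)).one_lt)
      positivity
  have hD : ∑ y ∈ T, (1 / (y : ℝ)) * ∑ n ∈ y.divisors, (vonMangoldt n : ℝ) * (g y - g (y / n)) ^ 2 ≤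
      ∑ x ∈ S, (1 / (x : ℝ)) * ∑ n ∈ x.divisors, (vonMangoldt n : ℝ) * (g x - g (x / n)) ^ 2 :=
    Finset.sum_le_sum_of_subset_of_nonneg (Finset.filter_subset _ _) fun x _ _ =>
      mul_nonneg (by positivity) (Finset.sum_nonneg fun n _ =>
        mul_nonneg ArithmeticFunction.vonMangoldt_nonneg (sq_nonneg _))
  have hD0 : 0 ≤ ∑ y ∈ T, (1 / (y : ℝ)) * ∑ n ∈ y.divisors, (vonMangoldt n : ℝ) * (g y - g (y / n)) ^ 2 :=
    Finset.sum_nonneg fun y _ => mul_nonneg (by positivity) (Finset.sum_nonneg fun n _ =>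
      mul_nonneg ArithmeticFunction.vonMangoldt_nonneg (sq_nonneg _))
  have hE0 : 0 ≤ ∑ y ∈ Icc 2 R, P y ^ 2 / ((y : ℝ) * Real.log y.minFac) :=
    Finset.sum_nonneg fun y hy => by
      have hy2 := (Finset.mem_Icc.1 hy).1
      have : 0 < Real.log y.minFac :=
        Real.log_pos (by exact_mod_cast (Nat.minFac_prime (by omega)).one_lt)
      positivity
  exact h.trans (mul_le_mul hE hD hD0 hE0)

end Summit.RiemannHypothesis.RiemannHypothesis.Theorems.IntegerScrew

end
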